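import Literature.Probability.FitznerVanDerHofstad2017.SrwWSplitHybridKernel
import Literature.Probability.FitznerVanDerHofstad2017.SrwOrbitShellLaw
import HarnessLib

/-!
# Kernel hook for the orbit SHELL LAW at the scaled indicator classes `c·1^r`

Literature support (Fitzner–van der Hofstad, *Mean-field behavior for nearest-neighbor percolation in `d > 10`*,
EJP 22 (2017) §4.2, with the NoBLE analysis *Generalized approach to the non-backtracking lace expansion*,
PTRF 169 (2017): the placement formula (5.16) p. 1092 for the weighted bubble `W_{n,j}(x)` and the far node
`K ≤ √(I(0)·W)` of §5.1.2).  The tree's `SrwOrbitShellLaw` evaluates (5.16) EXACTLY at `x = c·1_S`: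
`W_{n,j}(c·1_S) ≤ C(d,s)⁻¹ Σ_{|T|=s} 2^{-|S∩T|} Σ_b C(|S∩T|,b) B(|SΔT|, b)` for any shell majorant
`B(a,b) ≥ I_{n,2j}(c·1^a 2^b)` (`srwW_smul_indicatorVec_le_of_shellBound`).  This module makes that bound a
kernel-decidable rational for `n = 1`:

* §1 `card_filter_powersetCard_inter_eq` (`#{|T| = r, |S∩T| = t} = C(s,t)·C(d-s,r-t)`) and the regrouping
  `sum_powersetCard_inter_regroup` of a sum over `s`-sets by the intersection size — so the evaluator costs
  `(s+1)(s+2)/2` law partial sums, not `C(d,s)·(s+1)`;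
* §2 `shellPt`/`shellLawQ d c a b L N Λ T` (SRW-law partial sum on the LITERAL list `|c|^a (2|c|)^b` + extended
  origin column of `SrwOriginTailKernel`; `srwI_smul_classVec_le_shellLawQ`), `shellWBoundQ d c r L N Λ T` — the
  shell law with `B(a,b) = shellLawQ` — and **`srwW_smul_lowSet_le_shellWBoundQ`**;
* §3 ENTRYWISE-CERTIFIED shell tables (a user table family `BQ c r L a b` of any provenance, re-checked entry by
  entry by `shellFlatLe` — one law partial sum per entry, chunkable — and read by `shellWTabQ`;
  `srwW_smul_lowSet_le_shellWTabQ`), the far value `shellFarQ` (two-step Newton of `√(A·B)` on the `2^{-80}` grid,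
  as in the hybrid kernel) at a user SPLIT POLICY `M` (`K_{1,m+j'} ≤ √(I_{1,2m}(0)·W_{1,j'})`, `m = min (M i l) 2J`;
  also for the hybrid value: `hybFarSplitQ`, `srwK_le_hybFarSplitQ` — the symmetric `M = J` is `hybFarQ`), the guard
  `scaledIndGuard d l` (decides `canonSite d l = c • 1_{μ<r}` for the digits `(c, r)` read off `l`), the combined far
  value **`bestFarQ = min(hybFarSplitQ, shellFarQ)`** on guarded classes with a certified key (else `hybFarSplitQ`)
  with `srwK_le_bestFarQ`, the chunkable table `bestFarLeTable` and the `WBX` cell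
  `toReal_tsum_sq_weighted_repBubble_le_policyXBounds_bestTable_of_originTable` (binders: origin table `hT`,
  weight-table admissibility `hα`, shell-table check `hfl` — certified at its OWN law depth `Ns`, independent of the
  hybrid depth `N`); and the consumer's COST KNOB `selFarQ … sel`
  (= `bestFarQ` on the classes selected by `sel`, the instant `x`-uniform cap `srwIZeroExtQ d Λ T (2J)` — (5.14)
  — elsewhere) with `srwK_le_selFarQ`, `selFarLeTable` and the cell `…_selTable_of_originTable`.

No dimension is fixed and no numeral of any certificate occurs; `d = 3, 4` examples only.  Which lane a certificate
built on it belongs to is decided by the ORDERS of the build, not here.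
-/

namespace Literature.Probability.FitznerVanDerHofstad2017

open _root_.MeasureTheory Finset
open Literature.Barriers.CriticalPhenomena Literature.Probability.Percolation
open Literature.Probability.LatticeModels
open SrwCount (coordD)
open scoped BigOperators ENNReal symmDiff

variable {d : ℕ}

/-! ### §1. Regrouping the `s`-subsets of `[d]` by their intersection with `S` -/

/-- `#{T ⊆ [d] : |T| = r, |S ∩ T| = t} = C(|S|, t) · C(d - |S|, r - t)` (`t ≤ r`).
[cite: FitznerVanDerHofstad2016NoBLE, (5.16) p. 1092] -/
theorem card_filter_powersetCard_inter_eq (S : Finset (Fin d)) {r t : ℕ} (ht : t ≤ r) :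
    ((powersetCard r (univ : Finset (Fin d))).filter fun T => (S ∩ T).card = t).card =
      S.card.choose t * (d - S.card).choose (r - t) := by
  have key : ((powersetCard r (univ : Finset (Fin d))).filter fun T => (S ∩ T).card = t).card =
      ((powersetCard t S) ×ˢ (powersetCard (r - t) Sᶜ)).card := by
    refine Finset.card_bij' (fun T _ => (S ∩ T, T \ S)) (fun AB _ => AB.1 ∪ AB.2) ?_ ?_ ?_ ?_
    · intro T hT
      simp only [mem_filter, mem_powersetCard, subset_univ, true_and] at hT
      simp only [mem_product, mem_powersetCard]
      refine ⟨⟨inter_subset_left, hT.2⟩, ⟨fun μ hμ => mem_compl.2 (mem_sdiff.1 hμ).2, ?_⟩⟩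
      have h1 := card_sdiff_add_card_inter T S
      rw [inter_comm] at h1
      omega
    · intro AB hAB
      obtain ⟨A, B⟩ := AB
      simp only [mem_product, mem_powersetCard] at hAB
      obtain ⟨⟨hAS, hA⟩, hBS, hB⟩ := hAB
      have hdisj : Disjoint A B := by
        rw [Finset.disjoint_left]
        intro μ hμA hμB
        exact (mem_compl.1 (hBS hμB)) (hAS hμA)
      have hSAB : S ∩ (A ∪ B) = A := by
        ext μ
        simp only [mem_inter, mem_union]
        constructor
        · rintro ⟨hμS, hμA | hμB⟩
          · exact hμA
          · exact absurd hμS (mem_compl.1 (hBS hμB))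
        · intro hμA
          exact ⟨hAS hμA, Or.inl hμA⟩
      simp only [mem_filter, mem_powersetCard, subset_univ, true_and]
      refine ⟨?_, by rw [hSAB, hA]⟩
      rw [card_union_of_disjoint hdisj, hA, hB]
      omega
    · intro T _
      ext μ
      simp only [mem_union, mem_inter, mem_sdiff]
      tauto
    · intro AB hAB
      obtain ⟨A, B⟩ := AB
      simp only [mem_product, mem_powersetCard] at hAB
      obtain ⟨⟨hAS, hA⟩, hBS, hB⟩ := hAB
      refine Prod.ext ?_ ?_
      · ext μ
        simp only [mem_inter, mem_union]
        constructor
        · rintro ⟨hμS, hμA | hμB⟩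
          · exact hμA
          · exact absurd hμS (mem_compl.1 (hBS hμB))
        · intro hμA
          exact ⟨hAS hμA, Or.inl hμA⟩
      · ext μ
        simp only [mem_sdiff, mem_union]
        constructor
        · rintro ⟨hμA | hμB, hμS⟩
          · exact absurd (hAS hμA) hμS
          · exact hμB
        · intro hμB
          exact ⟨Or.inr hμB, mem_compl.1 (hBS hμB)⟩
  rw [key, card_product, card_powersetCard, card_powersetCard, card_compl, Fintype.card_fin]

/-- **Regrouping by intersection size**: `Σ_{|T|=r} g(|S∩T|) = Σ_{t ≤ r} C(|S|,t)·C(d-|S|,r-t)·g(t)`.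
[cite: FitznerVanDerHofstad2016NoBLE, (5.16) p. 1092] -/
theorem sum_powersetCard_inter_regroup (S : Finset (Fin d)) (r : ℕ) (g : ℕ → ℝ) :
    ∑ T ∈ powersetCard r (univ : Finset (Fin d)), g (S ∩ T).card =
      ∑ t ∈ range (r + 1), ((S.card.choose t * (d - S.card).choose (r - t) : ℕ) : ℝ) * g t := by
  rw [← sum_fiberwise_of_maps_to (s := powersetCard r univ) (t := range (r + 1))
    (g := fun T : Finset (Fin d) => (S ∩ T).card) ?_ (fun T => g (S ∩ T).card)]
  · refine sum_congr rfl fun t ht => ?_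
    have ht' : t ≤ r := Nat.lt_succ_iff.mp (mem_range.mp ht)
    rw [sum_congr rfl fun T hT => by rw [(mem_filter.1 hT).2], sum_const,
      card_filter_powersetCard_inter_eq S ht', nsmul_eq_mul]
  · intro T hT
    rw [mem_powersetCard] at hT
    exact mem_range.2 (Nat.lt_succ_of_le ((card_le_card inter_subset_right).trans hT.2.le))

/-! ### §2. The kernel shell majorant of `W_{1,j}(c·1^r)` -/

/-- The first `r` coordinates `{μ : μ < r}`. [folklore] -/
def lowSet (d r : ℕ) : Finset (Fin d) := univ.filter fun μ => (μ : ℕ) < r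

/-- The LITERAL absolute-coordinate list of the shell point `c·1^a 2^b` (cut at `d`): `|c|^a (2|c|)^b` — the fast
kernel path of `srwLawPartialQ` (no `List.ofFn`, no trailing zeros). [folklore] -/
def shellPt (d : ℕ) (c : ℤ) (a b : ℕ) : List ℕ :=
  (List.replicate a c.natAbs ++ List.replicate b (2 * c.natAbs)).take d

/-- Positional agreement of `shellPt` with `c • classVec d a b`.
[cite: FitznerVanDerHofstad2016NoBLE, §5.1.1 (5.4)–(5.5) pp. 1089–1090] -/
theorem natAbs_coordD_smul_classVec (c : ℤ) (a b j : ℕ) :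
    (coordD (c • classVec d a b) j).natAbs = (shellPt d c a b).getD j 0 := by
  unfold coordD shellPt
  rw [List.getD_eq_getElem?_getD, List.getElem?_take]
  by_cases hj : j < d
  · rw [dif_pos hj, if_pos hj, List.getElem?_append]
    simp only [Pi.smul_apply, smul_eq_mul, classVec, List.length_replicate, List.getElem?_replicate]
    by_cases h1 : j < a
    · simp [h1]
    · by_cases h2 : j < a + b
      · have h3 : j - a < b := by omega
        simp [h1, h2, h3, Int.natAbs_mul, mul_comm]
      · have h3 : ¬ j - a < b := by omega
        simp [h1, h2, h3]
  · rw [dif_neg hj, if_neg hj]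
    simp

/-- `shellLawQ d c a b L N Λ T = Σ_{L ≤ i < L+N} p_i(c·1^a 2^b; d) + (extended origin column at L+N)` on the literal
list `shellPt`. [cite: FitznerVanDerHofstad2016NoBLE, §5.1.1 (5.4)–(5.5) pp. 1089–1090; (5.14) p. 1092] -/
def shellLawQ (d : ℕ) (c : ℤ) (a b L N Λ : ℕ) (T : ℕ → ℚ) : ℚ :=
  srwLawPartialQ d (shellPt d c a b) L N + srwIZeroExtQ d Λ T (L + N)

/-- **`I_{1,L}(c·1^a 2^b) ≤ ↑(shellLawQ d c a b L N Λ T)`** (`d ≥ 3`, origin table `hT`; any `a, b`).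
[cite: FitznerVanDerHofstad2016NoBLE, §5.1.1 (5.4)–(5.5) pp. 1089–1090] -/
theorem srwI_smul_classVec_le_shellLawQ (hd : 3 ≤ d) {Λ : ℕ} {T : ℕ → ℚ}
    (hT : ∀ l ≤ Λ, srwI d 1 l 0 ≤ (T l : ℝ)) (c : ℤ) (a b L N : ℕ) :
    srwI d 1 L (c • classVec d a b) ≤ ((shellLawQ d c a b L N Λ T : ℚ) : ℝ) := by
  rw [shellLawQ, Rat.cast_add]
  refine srwI_one_le_partialQ_add_extQ hd ?_ (natAbs_coordD_smul_classVec c a b) hT L N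
  simp [shellPt]

/-- The kernel SHELL MAJORANT of `W_{1,j}(c·1_S)`, `S = {μ < r}`, `s = |S|`, at `D̂`-power `L = 2j`:
`C(d,s)⁻¹ Σ_{t ≤ s} C(s,t) C(d-s,s-t) 2^{-t} Σ_{b ≤ t} C(t,b) · shellLawQ d c (2(s-t)) b L N Λ T` — the placement
formula (5.16) with every `I`-value replaced by its law-plus-extended-origin-column majorant.
[cite: FitznerVanDerHofstad2016NoBLE, (5.16) p. 1092; §5.1.1 (5.4)–(5.5) pp. 1089–1090] -/
def shellWBoundQ (d : ℕ) (c : ℤ) (r L N Λ : ℕ) (T : ℕ → ℚ) : ℚ :=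
  (∑ t ∈ range ((lowSet d r).card + 1),
      (((lowSet d r).card.choose t * (d - (lowSet d r).card).choose ((lowSet d r).card - t) : ℕ) : ℚ) *
        (((1 : ℚ) / 2) ^ t * ∑ b ∈ range (t + 1), ((t.choose b : ℕ) : ℚ) *
          shellLawQ d c (2 * ((lowSet d r).card - t)) b L N Λ T)) /
    (d.choose (lowSet d r).card : ℚ)

/-- **`W_{1,j}(c·1_{μ<r}) ≤ ↑(shellWBoundQ d c r (2j) N Λ T)`** (`d ≥ 3`, origin table `hT`): the tree's shell law
`srwW_smul_indicatorVec_le_of_shellBound` with `B = shellLawQ`, regrouped by `|S ∩ T|`.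
[cite: FitznerVanDerHofstad2016NoBLE, (5.16) p. 1092] -/
theorem srwW_smul_lowSet_le_shellWBoundQ (hd : 3 ≤ d) {Λ : ℕ} {T : ℕ → ℚ}
    (hT : ∀ l ≤ Λ, srwI d 1 l 0 ≤ (T l : ℝ)) (c : ℤ) (r j N : ℕ) :
    srwW d 1 j (c • indicatorVec (lowSet d r)) ≤ ((shellWBoundQ d c r (2 * j) N Λ T : ℚ) : ℝ) := by
  set S := lowSet d r with hSdef
  let B : ℕ → ℕ → ℝ := fun a b => ((shellLawQ d c a b (2 * j) N Λ T : ℚ) : ℝ)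
  have h := srwW_smul_indicatorVec_le_of_shellBound (n := 1) (by omega) j c S B
    (fun a b _ => srwI_smul_classVec_le_shellLawQ hd hT c a b (2 * j) N)
  refine h.trans (le_of_eq ?_)
  have hΔ : ∀ T' ∈ powersetCard S.card (univ : Finset (Fin d)),
      (S ∆ T').card = 2 * (S.card - (S ∩ T').card) := by
    intro T' hT'
    have h1 := card_symmDiff_add_card_inter S T'
    have h2 := card_union_add_card_inter S T'
    have h3 := (mem_powersetCard.1 hT').2
    have h4 : (S ∩ T').card ≤ S.card := card_le_card inter_subset_left
    omega
  let g : ℕ → ℝ := fun t => ((1 : ℝ) / 2) ^ t *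
    ∑ b ∈ range (t + 1), ((t.choose b : ℕ) : ℝ) * B (2 * (S.card - t)) b
  rw [show (∑ T' ∈ powersetCard S.card (univ : Finset (Fin d)), ((1 : ℝ) / 2) ^ (S ∩ T').card *
      ∑ b ∈ range ((S ∩ T').card + 1), (((S ∩ T').card.choose b : ℕ) : ℝ) * B (S ∆ T').card b) =
      ∑ T' ∈ powersetCard S.card (univ : Finset (Fin d)), g (S ∩ T').card from
    sum_congr rfl fun T' hT' => by simp only [g, hΔ T' hT'], sum_powersetCard_inter_regroup S S.card g]
  simp only [g, B, shellWBoundQ, ← hSdef]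
  push_cast
  rfl

/-! ### §3. Entrywise-certified shell tables (one `decide` per `B`-entry) and the far values

At `d ≥ 10` one `shellLawQ` value costs seconds of kernel time, so the shell sum is NOT evaluated inside a class
table; instead a user-supplied table `BQ c r L a b` (ANY provenance — the kernel re-checks every entry it reads) is
certified ENTRYWISE by `shellFlatLe` (chunkable), and the far node reads the table. -/

/-- The shells `(a, b) = (2(s-t), b)`, `b ≤ t ≤ s`, read by the regrouped shell sum at support size `s`. [folklore] -/
def shellEntries (s : ℕ) : List (ℕ × ℕ) :=
  (List.range (s + 1)).flatMap fun t => (List.range (t + 1)).map fun b => (2 * (s - t), b)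

/-- The TABLE shell majorant of `W_{1,j}(c·1_{μ<r})`: the regrouped placement sum (5.16) reading a table `B a b`.
[cite: FitznerVanDerHofstad2016NoBLE, (5.16) p. 1092] -/
def shellWTabQ (d : ℕ) (B : ℕ → ℕ → ℚ) (r : ℕ) : ℚ :=
  (∑ t ∈ range ((lowSet d r).card + 1),
      (((lowSet d r).card.choose t * (d - (lowSet d r).card).choose ((lowSet d r).card - t) : ℕ) : ℚ) *
        (((1 : ℚ) / 2) ^ t * ∑ b ∈ range (t + 1), ((t.choose b : ℕ) : ℚ) * B (2 * ((lowSet d r).card - t)) b)) /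
    (d.choose (lowSet d r).card : ℚ)

/-- Entrywise check of a shell table at scale `c`, power `L`: every listed `(a, b)` has
`shellLawQ d c a b L N Λ T ≤ B a b`. [cite: FitznerVanDerHofstad2016NoBLE, §5.3.3 p. 1098] -/
def shellTableLe (d : ℕ) (c : ℤ) (L N Λ : ℕ) (T : ℕ → ℚ) (B : ℕ → ℕ → ℚ) (es : List (ℕ × ℕ)) : Bool :=
  es.all fun ab => decide (shellLawQ d c ab.1 ab.2 L N Λ T ≤ B ab.1 ab.2)

/-- Table monotonicity: a certified table dominates the law evaluator.
[cite: FitznerVanDerHofstad2016NoBLE, (5.16) p. 1092] -/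
theorem shellWBoundQ_le_shellWTabQ {c : ℤ} {r L N Λ : ℕ} {T : ℕ → ℚ} {B : ℕ → ℕ → ℚ}
    (h : shellTableLe d c L N Λ T B (shellEntries (lowSet d r).card) = true) :
    shellWBoundQ d c r L N Λ T ≤ shellWTabQ d B r := by
  have hmem : ∀ t ∈ range ((lowSet d r).card + 1), ∀ b ∈ range (t + 1),
      shellLawQ d c (2 * ((lowSet d r).card - t)) b L N Λ T ≤
        B (2 * ((lowSet d r).card - t)) b := by
    intro t ht b hb
    unfold shellTableLe at h
    have hin : (2 * ((lowSet d r).card - t), b) ∈ shellEntries (lowSet d r).card := by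
      simp only [shellEntries, List.mem_flatMap, List.mem_map, List.mem_range]
      exact ⟨t, mem_range.1 ht, b, mem_range.1 hb, rfl⟩
    have := (List.all_eq_true.1 h) _ hin
    simpa using this
  unfold shellWBoundQ shellWTabQ
  gcongr with t ht b hb
  exact hmem t ht b hb

/-- **`W_{1,j}(c·1_{μ<r}) ≤ ↑(shellWTabQ d B r)`** for a table certified at `(c, L = 2j)` (`d ≥ 3`, origin table `hT`).
[cite: FitznerVanDerHofstad2016NoBLE, (5.16) p. 1092] -/
theorem srwW_smul_lowSet_le_shellWTabQ (hd : 3 ≤ d) {Λ : ℕ} {T : ℕ → ℚ}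
    (hT : ∀ l ≤ Λ, srwI d 1 l 0 ≤ (T l : ℝ)) (c : ℤ) (r j N : ℕ) {B : ℕ → ℕ → ℚ}
    (h : shellTableLe d c (2 * j) N Λ T B (shellEntries (lowSet d r).card) = true) :
    srwW d 1 j (c • indicatorVec (lowSet d r)) ≤ ((shellWTabQ d B r : ℚ) : ℝ) :=
  (srwW_smul_lowSet_le_shellWBoundQ hd hT c r j N).trans (by exact_mod_cast shellWBoundQ_le_shellWTabQ h)

/-- The flat entry list of a key list `keys = [(c, r, L), …]`: all `(c, r, L, a, b)` the far node will read. [folklore] -/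
def shellFlat (d : ℕ) (keys : List (ℤ × ℕ × ℕ)) : List (ℤ × ℕ × ℕ × ℕ × ℕ) :=
  keys.flatMap fun k => (shellEntries (lowSet d k.2.1).card).map fun ab => (k.1, k.2.1, k.2.2, ab.1, ab.2)

/-- Entrywise check of a keyed family of shell tables `BQ c r L a b` on a flat entry list (chunk it with
`shellFlatLe_of_take_drop`; one entry = one law partial sum). [cite: FitznerVanDerHofstad2016NoBLE, §5.3.3 p. 1098] -/
def shellFlatLe (d N Λ : ℕ) (T : ℕ → ℚ) (BQ : ℤ → ℕ → ℕ → ℕ → ℕ → ℚ) (fl : List (ℤ × ℕ × ℕ × ℕ × ℕ)) : Bool :=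
  fl.all fun e => decide (shellLawQ d e.1 e.2.2.2.1 e.2.2.2.2 e.2.2.1 N Λ T ≤ BQ e.1 e.2.1 e.2.2.1 e.2.2.2.1 e.2.2.2.2)

/-- Chunking an entrywise check. [cite: FitznerVanDerHofstad2016NoBLE, §5.3.3 p. 1098] -/
theorem shellFlatLe_of_take_drop {N Λ : ℕ} {T : ℕ → ℚ} {BQ : ℤ → ℕ → ℕ → ℕ → ℕ → ℚ}
    {fl : List (ℤ × ℕ × ℕ × ℕ × ℕ)} (n : ℕ) (h₁ : shellFlatLe d N Λ T BQ (fl.take n) = true)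
    (h₂ : shellFlatLe d N Λ T BQ (fl.drop n) = true) : shellFlatLe d N Λ T BQ fl = true := by
  unfold shellFlatLe at *
  rw [← List.take_append_drop n fl, List.all_append, h₁, h₂, Bool.and_self]

/-- Reading one key's table out of a certified flat list. [cite: FitznerVanDerHofstad2016NoBLE, §5.3.3 p. 1098] -/
theorem shellTableLe_of_shellFlatLe {N Λ : ℕ} {T : ℕ → ℚ} {BQ : ℤ → ℕ → ℕ → ℕ → ℕ → ℚ}
    {keys : List (ℤ × ℕ × ℕ)} (h : shellFlatLe d N Λ T BQ (shellFlat d keys) = true) {c : ℤ} {r L : ℕ}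
    (hk : (c, r, L) ∈ keys) : shellTableLe d c L N Λ T (BQ c r L) (shellEntries (lowSet d r).card) = true := by
  unfold shellFlatLe at h
  unfold shellTableLe
  rw [List.all_eq_true] at h ⊢
  intro ab hab
  have hin : (c, r, L, ab.1, ab.2) ∈ shellFlat d keys := by
    simp only [shellFlat, List.mem_flatMap, List.mem_map]
    exact ⟨(c, r, L), hk, ab, hab, rfl⟩
  have h' := h _ hin
  simp only [decide_eq_true_eq] at h' ⊢
  exact h'

/-- The digits `(c, r)` of a class list `l = 0^{c-1} r` (trailing zeros ignored); meaningful only when the guard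
below confirms `canonSite d l = c • 1_{μ<r}`. [folklore] -/
def classDigits (l : List ℕ) : ℕ × ℕ :=
  let l' := (l.reverse.dropWhile fun m => m == 0).reverse
  (l'.length, l'.getLastD 0)

/-- Kernel guard: `canonSite d l` IS the scaled indicator `c • 1_{μ<r}` for `(c, r) = classDigits l`. [folklore] -/
def scaledIndGuard (d : ℕ) (l : List ℕ) : Bool :=
  decide (canonSite d l = ((classDigits l).1 : ℤ) • indicatorVec (lowSet d (classDigits l).2))

/-- The SPLIT of the far-node power `2J = m + j'`: origin side `m = min (M i l) (2J)` (a user policy `M`, clipped),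
`W` side `j' = 2J - m`; `M i l = J i l` is the symmetric split of `SrwWSplitHybridKernel.hybFarQ`. [folklore] -/
def splitM (M J : ℕ → List ℕ → ℕ) (i : ℕ) (l : List ℕ) : ℕ := min (M i l) (2 * J i l)

/-- The HYBRID far value at split `M`: two-step Newton of `√(A·B)` on the `2^{-80}` grid, `A = srwIZeroExtQ d Λ T (2m)`,
`B = hybWBoundQ d αQ l (2j') N tmax Λ T`. [cite: FitznerVanDerHofstad2016NoBLE, §5.1.2 (5.16) p. 1092] -/
def hybFarSplitQ (d Λ : ℕ) (T : ℕ → ℚ) (N tmax : ℕ) (αQ : ℕ → ℚ) (M J : ℕ → List ℕ → ℕ) (i : ℕ) (l : List ℕ) : ℚ :=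
  roundUpQ hybDen (amgmNewton2 (srwIZeroExtQ d Λ T (2 * splitM M J i l))
    (hybWBoundQ d αQ l (2 * (2 * J i l - splitM M J i l)) N tmax Λ T))

/-- **`K_{1,2J}(x_l) ≤ ↑(hybFarSplitQ …)`** (`d ≥ 3`, origin table `hT`, admissible weight table `hα`; any split
policy `M`): `K_{1,m+j'} ≤ √(I_{1,2m}(0) · W_{1,j'})`. [cite: FitznerVanDerHofstad2016NoBLE, §5.1.2 (5.16) p. 1092] -/
theorem srwK_le_hybFarSplitQ (hd : 3 ≤ d) {Λ : ℕ} {T : ℕ → ℚ} (hT : ∀ l ≤ Λ, srwI d 1 l 0 ≤ (T l : ℝ))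
    (N tmax : ℕ) {αQ : ℕ → ℚ} (hα : ∀ S : Finset (Fin d), ((αQ S.card : ℚ) : ℝ) * d.factorial ≤ (disPerms S).card)
    (M J : ℕ → List ℕ → ℕ) (i : ℕ) (l : List ℕ) :
    srwK d 1 (2 * J i l) (canonSite d l) ≤ ((hybFarSplitQ d Λ T N tmax αQ M J i l : ℚ) : ℝ) := by
  have hm : splitM M J i l ≤ 2 * J i l := Nat.min_le_right _ _
  have hA := srwI_one_zero_le_srwIZeroExtQ hd hT (2 * splitM M J i l)
  have hB := srwW_le_hybWBoundQ hd hT hα l (2 * J i l - splitM M J i l) N tmax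
  have hA0 : (0 : ℚ) ≤ srwIZeroExtQ d Λ T (2 * splitM M J i l) := by
    exact_mod_cast (srwI_zero_even_nonneg 1 (splitM M J i l)).trans hA
  have hB0 : (0 : ℚ) ≤ hybWBoundQ d αQ l (2 * (2 * J i l - splitM M J i l)) N tmax Λ T := by
    exact_mod_cast (srwW_nonneg 1 _ _).trans hB
  obtain ⟨hF, hAB⟩ := roundUpQ_amgmNewton2_spec hA0 hB0 (by decide : 0 < hybDen)
  have hF' : (0 : ℝ) ≤ ((hybFarSplitQ d Λ T N tmax αQ M J i l : ℚ) : ℝ) := by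
    unfold hybFarSplitQ; exact_mod_cast hF
  have hAB' : ((srwIZeroExtQ d Λ T (2 * splitM M J i l) : ℚ) : ℝ) *
      ((hybWBoundQ d αQ l (2 * (2 * J i l - splitM M J i l)) N tmax Λ T : ℚ) : ℝ) ≤
      ((hybFarSplitQ d Λ T N tmax αQ M J i l : ℚ) : ℝ) ^ 2 := by
    unfold hybFarSplitQ; exact_mod_cast hAB
  have h := srwK_le_of_srwW_cert (n := 1) (m := splitM M J i l) (j := 2 * J i l - splitM M J i l) (by omega)
    hA hB hF' hAB'
  rwa [Nat.add_sub_cancel' hm] at h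

/-- The SHELL far value of class `l` (read as `c·1^r`) at split `M` from a keyed table family `BQ`: two-step Newton of
`√(A·B)` on the `2^{-80}` grid with `A = srwIZeroExtQ d Λ T (2m)`, `B = shellWTabQ d (BQ c r (2j')) r`.
[cite: FitznerVanDerHofstad2016NoBLE, §5.1.2 (5.16) p. 1092] -/
def shellFarQ (d Λ : ℕ) (T : ℕ → ℚ) (BQ : ℤ → ℕ → ℕ → ℕ → ℕ → ℚ) (M J : ℕ → List ℕ → ℕ) (i : ℕ)
    (l : List ℕ) : ℚ :=
  roundUpQ hybDen (amgmNewton2 (srwIZeroExtQ d Λ T (2 * splitM M J i l))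
    (shellWTabQ d (BQ ((classDigits l).1 : ℤ) (classDigits l).2 (2 * (2 * J i l - splitM M J i l)))
      (classDigits l).2))

/-- **`K_{1,2J}(x_l) ≤ ↑(shellFarQ …)`** on a guarded class whose key `(c, r, 2j')` is certified (`d ≥ 3`, origin
table `hT`). [cite: FitznerVanDerHofstad2016NoBLE, §5.1.2 (5.16) p. 1092] -/
theorem srwK_le_shellFarQ (hd : 3 ≤ d) {Λ : ℕ} {T : ℕ → ℚ} (hT : ∀ l ≤ Λ, srwI d 1 l 0 ≤ (T l : ℝ))
    (N : ℕ) {BQ : ℤ → ℕ → ℕ → ℕ → ℕ → ℚ} {keys : List (ℤ × ℕ × ℕ)}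
    (hfl : shellFlatLe d N Λ T BQ (shellFlat d keys) = true) (M J : ℕ → List ℕ → ℕ) (i : ℕ) (l : List ℕ)
    (hg : scaledIndGuard d l = true)
    (hk : (((classDigits l).1 : ℤ), (classDigits l).2, 2 * (2 * J i l - splitM M J i l)) ∈ keys) :
    srwK d 1 (2 * J i l) (canonSite d l) ≤ ((shellFarQ d Λ T BQ M J i l : ℚ) : ℝ) := by
  have hm : splitM M J i l ≤ 2 * J i l := Nat.min_le_right _ _
  have hx : canonSite d l = ((classDigits l).1 : ℤ) • indicatorVec (lowSet d (classDigits l).2) := by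
    simpa [scaledIndGuard] using hg
  have hA := srwI_one_zero_le_srwIZeroExtQ hd hT (2 * splitM M J i l)
  have hB := srwW_smul_lowSet_le_shellWTabQ hd hT ((classDigits l).1 : ℤ) (classDigits l).2
    (2 * J i l - splitM M J i l) N (shellTableLe_of_shellFlatLe hfl hk)
  rw [← hx] at hB
  have hA0 : (0 : ℚ) ≤ srwIZeroExtQ d Λ T (2 * splitM M J i l) := by
    exact_mod_cast (srwI_zero_even_nonneg 1 (splitM M J i l)).trans hA
  have hB0 : (0 : ℚ) ≤ shellWTabQ d (BQ ((classDigits l).1 : ℤ) (classDigits l).2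
      (2 * (2 * J i l - splitM M J i l))) (classDigits l).2 := by
    exact_mod_cast (srwW_nonneg 1 _ _).trans hB
  obtain ⟨hF, hAB⟩ := roundUpQ_amgmNewton2_spec hA0 hB0 (by decide : 0 < hybDen)
  have hF' : (0 : ℝ) ≤ ((shellFarQ d Λ T BQ M J i l : ℚ) : ℝ) := by
    unfold shellFarQ; exact_mod_cast hF
  have hAB' : ((srwIZeroExtQ d Λ T (2 * splitM M J i l) : ℚ) : ℝ) *
      ((shellWTabQ d (BQ ((classDigits l).1 : ℤ) (classDigits l).2 (2 * (2 * J i l - splitM M J i l)))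
        (classDigits l).2 : ℚ) : ℝ) ≤ ((shellFarQ d Λ T BQ M J i l : ℚ) : ℝ) ^ 2 := by
    unfold shellFarQ; exact_mod_cast hAB
  have h := srwK_le_of_srwW_cert (n := 1) (m := splitM M J i l) (j := 2 * J i l - splitM M J i l) (by omega)
    hA hB hF' hAB'
  rwa [Nat.add_sub_cancel' hm] at h

/-- The BEST far value at split policy `M`: `min(hybFarSplitQ, shellFarQ)` on guarded classes with a certified key,
`hybFarSplitQ` elsewhere. [cite: FitznerVanDerHofstad2016NoBLE, §5.1.2 (5.16) p. 1092] -/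
def bestFarQ (d Λ : ℕ) (T : ℕ → ℚ) (N tmax : ℕ) (αQ : ℕ → ℚ) (BQ : ℤ → ℕ → ℕ → ℕ → ℕ → ℚ)
    (keys : List (ℤ × ℕ × ℕ)) (M J : ℕ → List ℕ → ℕ) (i : ℕ) (l : List ℕ) : ℚ :=
  if scaledIndGuard d l &&
      decide ((((classDigits l).1 : ℤ), (classDigits l).2, 2 * (2 * J i l - splitM M J i l)) ∈ keys) then
    min (hybFarSplitQ d Λ T N tmax αQ M J i l) (shellFarQ d Λ T BQ M J i l)
  else hybFarSplitQ d Λ T N tmax αQ M J i l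

/-- **`K_{1,2J}(x_l) ≤ ↑(bestFarQ …)`** (`d ≥ 3`, origin table `hT`, admissible weight table `hα`, certified shell
tables `hfl`; any split policy `M`). [cite: FitznerVanDerHofstad2016NoBLE, §5.1.2 (5.16) p. 1092] -/
theorem srwK_le_bestFarQ (hd : 3 ≤ d) {Λ : ℕ} {T : ℕ → ℚ} (hT : ∀ l ≤ Λ, srwI d 1 l 0 ≤ (T l : ℝ))
    (N tmax : ℕ) {αQ : ℕ → ℚ} (hα : ∀ S : Finset (Fin d), ((αQ S.card : ℚ) : ℝ) * d.factorial ≤ (disPerms S).card)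
    {BQ : ℤ → ℕ → ℕ → ℕ → ℕ → ℚ} {keys : List (ℤ × ℕ × ℕ)} {Ns : ℕ} (hfl : shellFlatLe d Ns Λ T BQ (shellFlat d keys) = true)
    (M J : ℕ → List ℕ → ℕ) (i : ℕ) (l : List ℕ) :
    srwK d 1 (2 * J i l) (canonSite d l) ≤ ((bestFarQ d Λ T N tmax αQ BQ keys M J i l : ℚ) : ℝ) := by
  unfold bestFarQ
  have h1 := srwK_le_hybFarSplitQ hd hT N tmax hα M J i l
  split_ifs with hg
  · rw [Bool.and_eq_true, decide_eq_true_eq] at hg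
    have h2 := srwK_le_shellFarQ hd hT Ns hfl M J i l hg.1 hg.2
    push_cast
    exact le_min h1 h2
  · exact h1

/-- `bestFarLeTable … f ls`: every class `l ∈ ls` has `bestFarQ … i l ≤ f l` (one `decide +kernel` per chunk).
[cite: FitznerVanDerHofstad2016NoBLE, §5.3.3 p. 1098; §5.1.2 (5.16) p. 1092] -/
def bestFarLeTable (d Λ : ℕ) (T : ℕ → ℚ) (N tmax : ℕ) (αQ : ℕ → ℚ) (BQ : ℤ → ℕ → ℕ → ℕ → ℕ → ℚ)
    (keys : List (ℤ × ℕ × ℕ)) (M J : ℕ → List ℕ → ℕ) (i : ℕ) (f : List ℕ → ℚ) (ls : List (List ℕ)) : Bool :=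
  ls.all fun l => decide (bestFarQ d Λ T N tmax αQ BQ keys M J i l ≤ f l)

/-- Chunking a table check. [cite: FitznerVanDerHofstad2016NoBLE, §5.3.3 p. 1098] -/
theorem bestFarLeTable_of_take_drop {Λ : ℕ} {T : ℕ → ℚ} {N tmax : ℕ} {αQ : ℕ → ℚ}
    {BQ : ℤ → ℕ → ℕ → ℕ → ℕ → ℚ} {keys : List (ℤ × ℕ × ℕ)} {M J : ℕ → List ℕ → ℕ}
    {i : ℕ} {f : List ℕ → ℚ} {ls : List (List ℕ)} (n : ℕ)
    (h₁ : bestFarLeTable d Λ T N tmax αQ BQ keys M J i f (ls.take n) = true)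
    (h₂ : bestFarLeTable d Λ T N tmax αQ BQ keys M J i f (ls.drop n) = true) :
    bestFarLeTable d Λ T N tmax αQ BQ keys M J i f ls = true := by
  unfold bestFarLeTable at *
  rw [← List.take_append_drop n ls, List.all_append, h₁, h₂, Bool.and_self]

/-- Reading a table check. [cite: FitznerVanDerHofstad2016NoBLE, §5.3.3 p. 1098; §5.1.2 (5.16) p. 1092] -/
theorem srwK_le_of_bestFarLeTable (hd : 3 ≤ d) {Λ : ℕ} {T : ℕ → ℚ} (hT : ∀ l ≤ Λ, srwI d 1 l 0 ≤ (T l : ℝ))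
    {N tmax : ℕ} {αQ : ℕ → ℚ} (hα : ∀ S : Finset (Fin d), ((αQ S.card : ℚ) : ℝ) * d.factorial ≤ (disPerms S).card)
    {BQ : ℤ → ℕ → ℕ → ℕ → ℕ → ℚ} {keys : List (ℤ × ℕ × ℕ)} {Ns : ℕ} (hfl : shellFlatLe d Ns Λ T BQ (shellFlat d keys) = true)
    {M J : ℕ → List ℕ → ℕ} {i : ℕ} {f : List ℕ → ℚ} {ls : List (List ℕ)}
    (h : bestFarLeTable d Λ T N tmax αQ BQ keys M J i f ls = true) :
    ∀ l ∈ ls, srwK d 1 (2 * J i l) (canonSite d l) ≤ ((f l : ℚ) : ℝ) := by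
  intro l hl
  unfold bestFarLeTable at h
  have h' := (List.all_eq_true.1 h) l hl
  simp only [decide_eq_true_eq] at h'
  exact (srwK_le_bestFarQ hd hT N tmax hα hfl M J i l).trans (by exact_mod_cast h')

/-- SELECTED far value: `bestFarQ` on the classes picked by `sel`, the `x`-uniform cap `srwIZeroExtQ d Λ T (2J)`
(`K_{1,2J}(x) ≤ I_{1,2J}(0) ≤ Ext(2J)`, instant in the kernel) elsewhere — the consumer's cost knob: the orbit / law
work is spent only where the split pays. [cite: FitznerVanDerHofstad2016NoBLE, (5.14)+(5.16) p. 1092; (5.26) p. 1094] -/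
def selFarQ (d Λ : ℕ) (T : ℕ → ℚ) (N tmax : ℕ) (αQ : ℕ → ℚ) (BQ : ℤ → ℕ → ℕ → ℕ → ℕ → ℚ)
    (keys : List (ℤ × ℕ × ℕ)) (M J : ℕ → List ℕ → ℕ) (sel : ℕ → List ℕ → Bool) (i : ℕ) (l : List ℕ) : ℚ :=
  if sel i l then bestFarQ d Λ T N tmax αQ BQ keys M J i l else srwIZeroExtQ d Λ T (2 * J i l)

/-- **`K_{1,2J}(x_l) ≤ ↑(selFarQ …)`** (`d ≥ 3`; origin table, weight table, shell tables as for `bestFarQ`).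
[cite: FitznerVanDerHofstad2016NoBLE, (5.14)+(5.16) p. 1092; (5.26) p. 1094] -/
theorem srwK_le_selFarQ (hd : 3 ≤ d) {Λ : ℕ} {T : ℕ → ℚ} (hT : ∀ l ≤ Λ, srwI d 1 l 0 ≤ (T l : ℝ))
    (N tmax : ℕ) {αQ : ℕ → ℚ} (hα : ∀ S : Finset (Fin d), ((αQ S.card : ℚ) : ℝ) * d.factorial ≤ (disPerms S).card)
    {BQ : ℤ → ℕ → ℕ → ℕ → ℕ → ℚ} {keys : List (ℤ × ℕ × ℕ)} {Ns : ℕ} (hfl : shellFlatLe d Ns Λ T BQ (shellFlat d keys) = true)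
    (M J : ℕ → List ℕ → ℕ) (sel : ℕ → List ℕ → Bool) (i : ℕ) (l : List ℕ) :
    srwK d 1 (2 * J i l) (canonSite d l) ≤ ((selFarQ d Λ T N tmax αQ BQ keys M J sel i l : ℚ) : ℝ) := by
  unfold selFarQ
  split_ifs
  · exact srwK_le_bestFarQ hd hT N tmax hα hfl M J i l
  · exact (srwK_le_srwI_zero_of_even (n := 1) (by omega) (J i l) _).trans
      (srwI_one_zero_le_srwIZeroExtQ hd hT (2 * J i l))

/-- `selFarLeTable … sel i f ls`: every class `l ∈ ls` has `selFarQ … i l ≤ f l`.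
[cite: FitznerVanDerHofstad2016NoBLE, §5.3.3 p. 1098; §5.1.2 (5.14)+(5.16) p. 1092] -/
def selFarLeTable (d Λ : ℕ) (T : ℕ → ℚ) (N tmax : ℕ) (αQ : ℕ → ℚ) (BQ : ℤ → ℕ → ℕ → ℕ → ℕ → ℚ)
    (keys : List (ℤ × ℕ × ℕ)) (M J : ℕ → List ℕ → ℕ) (sel : ℕ → List ℕ → Bool) (i : ℕ) (f : List ℕ → ℚ)
    (ls : List (List ℕ)) : Bool :=
  ls.all fun l => decide (selFarQ d Λ T N tmax αQ BQ keys M J sel i l ≤ f l)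

/-- Chunking a table check. [cite: FitznerVanDerHofstad2016NoBLE, §5.3.3 p. 1098] -/
theorem selFarLeTable_of_take_drop {Λ : ℕ} {T : ℕ → ℚ} {N tmax : ℕ} {αQ : ℕ → ℚ}
    {BQ : ℤ → ℕ → ℕ → ℕ → ℕ → ℚ} {keys : List (ℤ × ℕ × ℕ)} {M J : ℕ → List ℕ → ℕ} {sel : ℕ → List ℕ → Bool}
    {i : ℕ} {f : List ℕ → ℚ} {ls : List (List ℕ)} (n : ℕ)
    (h₁ : selFarLeTable d Λ T N tmax αQ BQ keys M J sel i f (ls.take n) = true)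
    (h₂ : selFarLeTable d Λ T N tmax αQ BQ keys M J sel i f (ls.drop n) = true) :
    selFarLeTable d Λ T N tmax αQ BQ keys M J sel i f ls = true := by
  unfold selFarLeTable at *
  rw [← List.take_append_drop n ls, List.all_append, h₁, h₂, Bool.and_self]

/-- Reading a table check. [cite: FitznerVanDerHofstad2016NoBLE, §5.3.3 p. 1098; §5.1.2 (5.14)+(5.16) p. 1092] -/
theorem srwK_le_of_selFarLeTable (hd : 3 ≤ d) {Λ : ℕ} {T : ℕ → ℚ} (hT : ∀ l ≤ Λ, srwI d 1 l 0 ≤ (T l : ℝ))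
    {N tmax : ℕ} {αQ : ℕ → ℚ} (hα : ∀ S : Finset (Fin d), ((αQ S.card : ℚ) : ℝ) * d.factorial ≤ (disPerms S).card)
    {BQ : ℤ → ℕ → ℕ → ℕ → ℕ → ℚ} {keys : List (ℤ × ℕ × ℕ)} {Ns : ℕ} (hfl : shellFlatLe d Ns Λ T BQ (shellFlat d keys) = true)
    {M J : ℕ → List ℕ → ℕ} {sel : ℕ → List ℕ → Bool} {i : ℕ} {f : List ℕ → ℚ} {ls : List (List ℕ)}
    (h : selFarLeTable d Λ T N tmax αQ BQ keys M J sel i f ls = true) :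
    ∀ l ∈ ls, srwK d 1 (2 * J i l) (canonSite d l) ≤ ((f l : ℚ) : ℝ) := by
  intro l hl
  unfold selFarLeTable at h
  have h' := (List.all_eq_true.1 h) l hl
  simp only [decide_eq_true_eq] at h'
  exact (srwK_le_selFarQ hd hT N tmax hα hfl M J sel i l).trans (by exact_mod_cast h')

/-- **`WBX` cell, selected far node by table** — as `…_bestTable_of_originTable` below with the far values certified by
`selFarLeTable` (best far node on `sel`, uniform cap elsewhere).
[cite: FitznerVanDerHofstad2016NoBLE, §5.3.1 (5.36)–(5.38) p. 1097, §5.1.2 (5.14)+(5.16) p. 1092; FitznerVanDerHofstad2017, §4.2 (4.18)] -/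
theorem toReal_tsum_sq_weighted_repBubble_le_policyXBounds_selTable_of_originTable {ι : Type*} [Fintype ι]
    [Nonempty ι] (hd : 3 ≤ d) {p : unitInterval} (hp : p ∈ Set.Ioo (nbwThresholdI d) (criticalProbI d))
    (m M : ℕ) {J : ℕ → List ℕ → ℕ} (hJ : ∀ i ∈ Icc m M, ∀ l ∈ liveList d i, i ≤ 2 * J i l)
    {𝒮 : ι → ℕ × ℕ × Set (Site d)} {cμ : ℝ} {c : ι → ℝ} (hc : ∀ k, 0 < c k) {γ : Fin 3 → ℚ}
    (hΓ : ∀ i, nobleFOf 𝒮 cμ c i p ≤ (γ i : ℝ)) {k : ι} (hk : 𝒮 k = (1, M + 1, {(0 : Site d)}))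
    {z : ℚ} (hpz : (p : ℝ) ≤ (z : ℝ)) {Λ : ℕ} {T : ℕ → ℚ} (hT : ∀ l ≤ Λ, srwI d 1 l 0 ≤ (T l : ℝ)) {N tmax : ℕ}
    {αQ : ℕ → ℚ} (hα : ∀ S : Finset (Fin d), ((αQ S.card : ℚ) : ℝ) * d.factorial ≤ (disPerms S).card)
    {BQ : ℤ → ℕ → ℕ → ℕ → ℕ → ℚ} {keys : List (ℤ × ℕ × ℕ)} {Ns : ℕ} (hfl : shellFlatLe d Ns Λ T BQ (shellFlat d keys) = true)
    {Msp : ℕ → List ℕ → ℕ} {sel : ℕ → List ℕ → Bool} {f : ℕ → List ℕ → ℚ}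
    (hf : ∀ i ∈ Icc m M, selFarLeTable d Λ T N tmax αQ BQ keys Msp J sel i (f i) (liveList d i) = true)
    {q : ℕ → ℚ} (hq : ∀ i ∈ Icc m M, wbxOrderPolicyXQ d i (J i) z (γ 1) (f i) ≤ q i) :
    (∑' y : Site d, ENNReal.ofReal (euclidNorm y ^ 2) *
        bondPercolation (zdGraph d) p (openConnGe m (0 : Site d) y □ openConn y 0)).toReal ≤
      (∑ i ∈ Icc m M, (z : ℝ) ^ i * (q i : ℝ)) + (2 * d * (z : ℝ)) ^ (M + 1) * ((γ 2 : ℝ) * c k) :=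
  toReal_tsum_sq_weighted_repBubble_le_policyXBounds_of_farValues hd hp m M hJ hc hΓ hk hpz
    (fun i hi l hl => srwK_le_of_selFarLeTable hd hT hα hfl (hf i hi) l hl) hq

/-- **`WBX` cell, best far node by table** — as `…_hybridTable_of_originTable` of `SrwWSplitHybridKernel`, with the
far values CERTIFIED by `bestFarLeTable` against `min(hybFarSplitQ, shellFarQ)` at a split policy `M`; extra
hypothesis: the entrywise shell-table check `hfl` (pointer language, no dimension).
[cite: FitznerVanDerHofstad2016NoBLE, §5.3.1 (5.36)–(5.38) p. 1097, §5.1.2 (5.16) p. 1092; FitznerVanDerHofstad2017, §4.2 (4.18)] -/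
theorem toReal_tsum_sq_weighted_repBubble_le_policyXBounds_bestTable_of_originTable {ι : Type*} [Fintype ι]
    [Nonempty ι] (hd : 3 ≤ d) {p : unitInterval} (hp : p ∈ Set.Ioo (nbwThresholdI d) (criticalProbI d))
    (m M : ℕ) {J : ℕ → List ℕ → ℕ} (hJ : ∀ i ∈ Icc m M, ∀ l ∈ liveList d i, i ≤ 2 * J i l)
    {𝒮 : ι → ℕ × ℕ × Set (Site d)} {cμ : ℝ} {c : ι → ℝ} (hc : ∀ k, 0 < c k) {γ : Fin 3 → ℚ}
    (hΓ : ∀ i, nobleFOf 𝒮 cμ c i p ≤ (γ i : ℝ)) {k : ι} (hk : 𝒮 k = (1, M + 1, {(0 : Site d)}))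
    {z : ℚ} (hpz : (p : ℝ) ≤ (z : ℝ)) {Λ : ℕ} {T : ℕ → ℚ} (hT : ∀ l ≤ Λ, srwI d 1 l 0 ≤ (T l : ℝ)) {N tmax : ℕ}
    {αQ : ℕ → ℚ} (hα : ∀ S : Finset (Fin d), ((αQ S.card : ℚ) : ℝ) * d.factorial ≤ (disPerms S).card)
    {BQ : ℤ → ℕ → ℕ → ℕ → ℕ → ℚ} {keys : List (ℤ × ℕ × ℕ)} {Ns : ℕ} (hfl : shellFlatLe d Ns Λ T BQ (shellFlat d keys) = true)
    {Msp : ℕ → List ℕ → ℕ} {f : ℕ → List ℕ → ℚ}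
    (hf : ∀ i ∈ Icc m M, bestFarLeTable d Λ T N tmax αQ BQ keys Msp J i (f i) (liveList d i) = true)
    {q : ℕ → ℚ} (hq : ∀ i ∈ Icc m M, wbxOrderPolicyXQ d i (J i) z (γ 1) (f i) ≤ q i) :
    (∑' y : Site d, ENNReal.ofReal (euclidNorm y ^ 2) *
        bondPercolation (zdGraph d) p (openConnGe m (0 : Site d) y □ openConn y 0)).toReal ≤
      (∑ i ∈ Icc m M, (z : ℝ) ^ i * (q i : ℝ)) + (2 * d * (z : ℝ)) ^ (M + 1) * ((γ 2 : ℝ) * c k) :=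
  toReal_tsum_sq_weighted_repBubble_le_policyXBounds_of_farValues hd hp m M hJ hc hΓ hk hpz
    (fun i hi l hl => srwK_le_of_bestFarLeTable hd hT hα hfl (hf i hi) l hl) hq

/-! ### §4. Examples (`d = 3, 4`; no certificate dimension) -/

/-- `d = 4`, `S = {0,1}`, `r = 2`: the `2`-subsets meeting `S` in exactly one point number `C(2,1)·C(2,1) = 4`. -/
example : ((powersetCard 2 (univ : Finset (Fin 4))).filter fun T => (({0, 1} : Finset (Fin 4)) ∩ T).card = 1).card
    = 4 := by decide +kernel

/-- The digits and the guard: `[0, 0, 2]` is `3·1^2 = (3,3,0,…)`, `[2]` is `1^2`, `[1, 1]` is not a scaled indicator;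
the entries read at `s = 2`. -/
example : classDigits [0, 0, 2] = (3, 2) ∧ classDigits [2, 0] = (1, 2) ∧ scaledIndGuard 4 [0, 0, 2] = true ∧
    scaledIndGuard 4 [2] = true ∧ scaledIndGuard 4 [1, 1] = false ∧
    shellEntries 2 = [(4, 0), (2, 0), (2, 1), (0, 0), (0, 1), (0, 2)] := by decide +kernel

/-- `d = 3`, toy origin column `T l = l`: a shell table family given BY THE LAW ITSELF certifies entrywise (key
`(c, r, L) = (1, 1, 4)`, three entries, two chunks), and the best-far table then certifies the classes `[1]`
(shell key present), `[2]`, `[1, 1]` (hybrid only). -/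
example : shellFlatLe 3 2 4 (fun l => (l : ℚ)) (fun c _ L a b => shellLawQ 3 c a b L 2 4 fun l => (l : ℚ))
    (shellFlat 3 [(1, 1, 4)]) = true :=
  shellFlatLe_of_take_drop 2 (by decide +kernel) (by decide +kernel)

example : bestFarLeTable 3 4 (fun l => (l : ℚ)) 2 3 (hybAlphaQ 3)
    (fun c _ L a b => shellLawQ 3 c a b L 2 4 fun l => (l : ℚ)) [(1, 1, 4)]
    (fun _ _ => 2) (fun _ _ => 2) 5 (fun _ => 4) [[1], [2], [1, 1]] = true :=
  bestFarLeTable_of_take_drop 1 (by decide +kernel) (by decide +kernel)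

example : selFarLeTable 3 4 (fun l => (l : ℚ)) 2 3 (hybAlphaQ 3)
    (fun c _ L a b => shellLawQ 3 c a b L 2 4 fun l => (l : ℚ)) [(1, 1, 4)]
    (fun _ _ => 2) (fun _ _ => 2) (fun _ l => decide (l = [1])) 5 (fun _ => 4) [[1], [2], [1, 1]] = true := by
  decide +kernel

/-- The symmetric split reproduces `hybFarQ` of `SrwWSplitHybridKernel`; an asymmetric one (`m = 3`, `j' = 1`) is a
different certified value. -/
example : hybFarSplitQ 3 4 (fun l => (l : ℚ)) 2 3 (hybAlphaQ 3) (fun _ _ => 2) (fun _ _ => 2) 5 [1] =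
    hybFarQ 3 4 (fun l => (l : ℚ)) 2 3 (hybAlphaQ 3) (fun _ _ => 2) 5 [1] ∧
    hybFarSplitQ 3 4 (fun l => (l : ℚ)) 2 3 (hybAlphaQ 3) (fun _ _ => 3) (fun _ _ => 2) 5 [1] ≠
    hybFarQ 3 4 (fun l => (l : ℚ)) 2 3 (hybAlphaQ 3) (fun _ _ => 2) 5 [1] := by decide +kernel

end Literature.Probability.FitznerVanDerHofstad2017
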